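import Summits.Ventures.PercRepro.Night2GeneralQCellsA
import Summits.Ventures.PercRepro.Night2GeneralQCellsB
import Summits.Ventures.PercRepro.Night2GeneralQCellsC

/-!
# PercRepro — THE REGIME `(q − 1, q − 3)` OF THE SHADOW ROW AT EVERY `q ≥ 4`, UNCONDITIONAL (night-2, gen 21)

`Night2ExcessGeneralQ` (gen 20) proved (LI_G) at every rank-`(q+1)` flat `G` of a simple loopless matroid with
`|E ∖ G| = q − 1` and `q − 3` coloops of `M|G` modulo the target sum of the per-basis loss bound; `Night2GeneralQPoly`
turned that sum into the polynomial inequality `PolyIneq q n` (`n = |G| − kColoops M G`) and proved it for `n ≥ 33`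
(`polyIneq_of_ge_33`); the cell files `Night2GeneralQCellsA/B/C` prove it for `6 ≤ n ≤ 32`.  Hence

* **`polyIneq_all`**: `PolyIneq q n` for every `q ≥ 4` and `n ≥ 6`;
* **`localShadowHall_qm1_qm3_all`**: THE REGIME `(q − 1, q − 3)` AT EVERY `q ≥ 4` WITH NO HYPOTHESIS ON THE FLAT —
  (LI_G) at every rank-`(q+1)` flat `G` with `|E ∖ G| = q − 1` and `kColoops M G = q − 3` of every simple loopless
  finite matroid (the cells `(4, 2)` of the row `q = 5`, `(5, 3)` of `q = 6`, `(6, 4)` of `q = 7`, `(7, 5)` of `q = 8`, …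
  at once; gen 19 / 20 had `q = 5, 6, 7, 8` by the size-only sum, which fails from `q = 9`).
-/

namespace PercRepro.Shadow

open Finset PerFlat ThmH

/-- **`PolyIneq q n` for every `q ≥ 4`, `n ≥ 6`**: the cells `6 ≤ n ≤ 32` by name, the tail `n ≥ 33` by the overlap
argument. -/
theorem polyIneq_all {q n : ℕ} (hq : 4 ≤ q) (hn : 6 ≤ n) : PolyIneq q n := by
  rcases le_or_gt 33 n with h33 | hlt
  · exact polyIneq_of_ge_33 hq h33
  · interval_cases n
    · exact polyIneq_six hq
    · exact polyIneq_seven hq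
    · exact polyIneq_eight hq
    · exact polyIneq_nine hq
    · exact polyIneq_ten hq
    · exact polyIneq_eleven hq
    · exact polyIneq_twelve hq
    · exact polyIneq_thirteen hq
    · exact polyIneq_fourteen hq
    · exact polyIneq_fifteen hq
    · exact polyIneq_sixteen hq
    · exact polyIneq_seventeen hq
    · exact polyIneq_eighteen hq
    · exact polyIneq_nineteen hq
    · exact polyIneq_twenty hq
    · exact polyIneq_twentyone hq
    · exact polyIneq_twentytwo hq
    · exact polyIneq_twentythree hq
    · exact polyIneq_twentyfour hq
    · exact polyIneq_twentyfive hq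
    · exact polyIneq_twentysix hq
    · exact polyIneq_twentyseven hq
    · exact polyIneq_twentyeight hq
    · exact polyIneq_twentynine hq
    · exact polyIneq_thirty hq
    · exact polyIneq_thirtyone hq
    · exact polyIneq_thirtytwo hq

variable {α : Type*} [DecidableEq α] {M : Matroid α} [M.Finite]

open scoped Classical in
/-- **THE REGIME `(q − 1, q − 3)` AT EVERY `q ≥ 4`, UNCONDITIONAL**: (LI_G) at every rank-`(q+1)` flat `G` of a simple
loopless finite matroid with `|E ∖ G| = q − 1` and `q − 3` coloops of `M|G`. -/
theorem localShadowHall_qm1_qm3_all {q : ℕ} (hq : 4 ≤ q) {G : Finset α} (hG : G ∈ flatsQ M (q + 1))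
    (hd : (gr M \ G).card = q - 1) (hk : kColoops M G = q - 3)
    (hs : ∀ e ∈ gr M, ∀ f ∈ gr M, e ≠ f → rkN M {e, f} = 2) (hl : ∀ e ∈ gr M, M.Indep {e}) :
    LocalShadowHall M q G :=
  localShadowHall_qm1_qm3_of_polyIneq hq hG hd hk hs hl (fun hn => polyIneq_all hq hn)

end PercRepro.Shadow
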